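import Mathlib.NumberTheory.Padics.RingHoms
import Summits.BirchSwinnertonDyer.BirchSwinnertonDyer.Theorems.Rank2Observatory2DescClSplitImageTree
import HarnessLib

/-!
# BirchSwinnertonDyer — rank ≥ 2 observatory: KERNEL-2DESC-CL — SPLIT LOCAL IMAGE: the square-class interface and its bridges (M3b part 1, odd `ℓ`)

HONEST FRAMING: per-curve certified theorems and census instruments; no claim on BSD in rank ≥ 2.

The computable tree `splitImgOdd ℓ ē` of `…SplitImageTree` (M3a) lists 6-bit class vectors.  This module proves it
is SOUND: for an odd prime `ℓ`, roots `e₀, e₁, e₂ ∈ ℤ_ℓ` congruent to pairwise distinct integers `ē_i` modulo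
`ℓ^K`, `K = D + 1` (`D = max v_ℓ(ē_i − ē_j)`), and ANY point `(x, y)`, `y ≠ 0`, of `y² = (x − e₀)(x − e₁)(x − e₂)` over
`ℚ_ℓ`, the vector of square classes `(cls (x − e_i))_i` is produced by the tree (`vecOdd_mem_splitImgOdd`, part 2
`…SplitImageSound`).  THIS FILE (part 1): the interface, the finite bit algebra, the bridge `valInt = padicValInt`, Euler's
criterion for `nonsqBit`, the integer lemmas on the tree data (terminal separation) and the `ℓ`-adic lemmas (digits,
the square condition, the class of a determined root).

The square-class map enters through an explicit INTERFACE `SqClassMapOdd ℓ` (a structure passed as an argument, no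
instances): a map `cls : ℚ_ℓ → Bool × Bool` that is multiplicative on non-zero elements (componentwise XOR) and whose
value on `a + ℓ^M ℤ_ℓ`, `a ∈ ℤ ∖ 0`, `v_ℓ(a) < M`, is `(v_ℓ(a) mod 2, [(a ℓ^{-v}/ℓ) = −1])`.  The genuine square-class
map of `ℚ_ℓ^×/ℚ_ℓ^{×2} ≅ (ℤ/2)²` is such a structure (module M1, `…PadicSquareClass`); soundness needs nothing else,
so this file does not depend on its construction.

Sorry-free; axioms `propext`, `Classical.choice`, `Quot.sound`.
[cite: Cassels1991LecturesEllipticCurves, §15] [cite: Cohen1993, §1.4.2]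
-/

set_option linter.dupNamespace false
set_option autoImplicit false

namespace Summit.BirchSwinnertonDyer.BirchSwinnertonDyer.Rank2Observatory.TwoDescCl.SplitImage

open Summit.BirchSwinnertonDyer.BirchSwinnertonDyer.Rank2Observatory.TwoDescCl
  (eulerBit eulerBit_iff_legendreSym intCast_zmod_ne_zero)

/-! ## §0 The interface -/

/-- A SQUARE-CLASS MAP at an odd prime `ℓ`: `cls z = (v_ℓ(z) mod 2, [unit part is a non-square])`, multiplicative on
`ℚ_ℓ^×` (componentwise XOR), and computed on a coset `a + ℓ^M ℤ_ℓ` (`a ∈ ℤ ∖ 0`, `v_ℓ(a) < M`) from the integer `a`.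
An explicit structure (no instance); constructed in `…PadicSquareClass` (M1). [cite: Cassels1991LecturesEllipticCurves, §15] -/
structure SqClassMapOdd (ℓ : ℕ) [Fact ℓ.Prime] where
  /-- the class of `z` as two bits `(v mod 2, non-square unit part)` (value on `0` irrelevant) -/
  cls : ℚ_[ℓ] → Bool × Bool
  /-- multiplicativity on non-zero elements -/
  cls_mul : ∀ z w : ℚ_[ℓ], z ≠ 0 → w ≠ 0 → cls (z * w) = ((cls z).1 != (cls w).1, (cls z).2 != (cls w).2)
  /-- local constancy: the class of `a + ℓ^M t` is read off the integer `a` when `v_ℓ(a) < M` -/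
  cls_approx : ∀ (z : ℚ_[ℓ]) (a : ℤ) (M : ℕ) (t : ℤ_[ℓ]), a ≠ 0 → padicValInt ℓ a < M →
    z = (a : ℚ_[ℓ]) + (ℓ : ℚ_[ℓ]) ^ M * (t : ℚ_[ℓ]) →
    cls z = (decide (padicValInt ℓ a % 2 = 1), decide (legendreSym ℓ (a / (ℓ : ℤ) ^ padicValInt ℓ a) = -1))

/-- The 6-bit vector of three classes. [folklore] -/
def vec3 (c₀ c₁ c₂ : Bool × Bool) : ℕ := mkOdd 0 c₀.1 c₀.2 + mkOdd 1 c₁.1 c₁.2 + mkOdd 2 c₂.1 c₂.2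

/-- The class vector of a point with abscissa `x`: `(cls (x − e_i))_i` as a 6-bit mask.
[cite: Cassels1991LecturesEllipticCurves, §15] -/
noncomputable def vecOdd {ℓ : ℕ} [Fact ℓ.Prime] (S : SqClassMapOdd ℓ) (x : ℚ_[ℓ]) (e : Fin 3 → ℤ_[ℓ]) : ℕ :=
  vec3 (S.cls (x - (e 0 : ℚ_[ℓ]))) (S.cls (x - (e 1 : ℚ_[ℓ]))) (S.cls (x - (e 2 : ℚ_[ℓ])))

/-! ## §1 Bit algebra (finite checks) -/

/-- Every pair of bits is one of the `fourClasses`. [folklore] -/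
theorem mem_fourClasses (c : Bool × Bool) : c ∈ fourClasses := by
  obtain ⟨a, b⟩ := c; cases a <;> cases b <;> decide

/-- On a class vector, `sqOkOdd` tests that the componentwise XOR of the three classes vanishes. [folklore] -/
theorem sqOkOdd_vec3 (c₀ c₁ c₂ : Bool × Bool) :
    sqOkOdd (vec3 c₀ c₁ c₂) =
      ((((c₀.1 != c₁.1) != c₂.1) == false) && (((c₀.2 != c₁.2) != c₂.2) == false)) := by
  obtain ⟨a0, b0⟩ := c₀; obtain ⟨a1, b1⟩ := c₁; obtain ⟨a2, b2⟩ := c₂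
  cases a0 <;> cases b0 <;> cases a1 <;> cases b1 <;> cases a2 <;> cases b2 <;> decide

/-- Three trivial classes give the zero mask. [folklore] -/
theorem vec3_false : vec3 (false, false) (false, false) (false, false) = 0 := by decide

/-! ## §2 The computable valuation is `padicValNat` -/

section Val
variable {ℓ : ℕ} [hp : Fact ℓ.Prime]

/-- The fuel-bounded loop `valNatAux` computes `padicValNat` once the fuel bounds the argument. [folklore] -/
theorem valNatAux_eq (fuel : ℕ) : ∀ n, 0 < n → n ≤ fuel → valNatAux ℓ fuel n = padicValNat ℓ n := by
  induction fuel with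
  | zero => intro n hn hle; omega
  | succ fuel ih =>
    intro n hn hle
    have h2 : 2 ≤ ℓ := hp.out.two_le
    have hl : ¬ ℓ ≤ 1 := by omega
    have hn0 : n ≠ 0 := by omega
    show (if n = 0 then fuel + 1 else if ℓ ≤ 1 then 0
      else if n % ℓ = 0 then valNatAux ℓ fuel (n / ℓ) + 1 else 0) = _
    rw [if_neg hn0, if_neg hl]
    by_cases hd : n % ℓ = 0
    · rw [if_pos hd]
      have hdvd : ℓ ∣ n := Nat.dvd_of_mod_eq_zero hd
      have hq : 0 < n / ℓ := Nat.div_pos (Nat.le_of_dvd hn hdvd) (by omega)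
      have hqlt : n / ℓ < n := Nat.div_lt_self hn (by omega)
      rw [ih _ hq (by omega), padicValNat.div hdvd]
      have := one_le_padicValNat_of_dvd hn0 hdvd
      omega
    · rw [if_neg hd]
      exact (padicValNat.eq_zero_of_not_dvd fun h => hd (Nat.mod_eq_zero_of_dvd h)).symm

/-- `valNat ℓ n = padicValNat ℓ n` for `n > 0`. [folklore] -/
theorem valNat_eq {n : ℕ} (hn : 0 < n) : valNat ℓ n = padicValNat ℓ n := valNatAux_eq n n hn le_rfl

/-- **Bridge**: M3a's fuel-bounded valuation is `padicValInt` on non-zero integers. [folklore] -/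
theorem valInt_eq {z : ℤ} (hz : z ≠ 0) : valInt ℓ z = padicValInt ℓ z :=
  valNat_eq (Int.natAbs_pos.mpr hz)

omit hp in
/-- `valInt` is invariant under negation. [folklore] -/
theorem valInt_neg (z : ℤ) : valInt ℓ (-z) = valInt ℓ z := by
  simp [valInt, Int.natAbs_neg]

/-- `ℓ^K ∣ z` iff `z = 0` or `K ≤ valInt ℓ z`. [folklore] -/
theorem pow_dvd_iff_valInt (K : ℕ) (z : ℤ) : (ℓ : ℤ) ^ K ∣ z ↔ z = 0 ∨ K ≤ valInt ℓ z := by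
  rw [padicValInt_dvd_iff]
  by_cases hz : z = 0
  · simp [hz]
  · rw [valInt_eq hz]

/-- The unit part `a / ℓ^{v(a)}` of a non-zero integer is prime to `ℓ`. [folklore] -/
theorem not_dvd_div_pow_padicValInt {a : ℤ} (ha : a ≠ 0) : ¬ (ℓ : ℤ) ∣ a / (ℓ : ℤ) ^ padicValInt ℓ a := by
  intro h
  have hd : (ℓ : ℤ) ^ padicValInt ℓ a ∣ a := padicValInt_dvd a
  have : (ℓ : ℤ) ^ (padicValInt ℓ a + 1) ∣ a := by
    obtain ⟨c, hc⟩ := h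
    refine ⟨c, ?_⟩
    calc a = a / (ℓ : ℤ) ^ padicValInt ℓ a * (ℓ : ℤ) ^ padicValInt ℓ a := (Int.ediv_mul_cancel hd).symm
      _ = _ := by rw [hc]; ring
  rcases (padicValInt_dvd_iff _ _).mp this with h0 | hle
  · exact ha h0
  · omega

/-- **Bridge**: Euler's criterion — M3a's `nonsqBit` is the Legendre symbol test on units.
[cite: Cohen1993, §1.4.2] -/
theorem nonsqBit_eq (hℓ : ℓ ≠ 2) {u : ℤ} (hu : ¬ (ℓ : ℤ) ∣ u) :
    nonsqBit ℓ u = decide (legendreSym ℓ u = -1) := by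
  have hne : ((u % (ℓ : ℤ) : ℤ) : ZMod ℓ) ≠ 0 := by
    rw [ZMod.intCast_mod]; exact intCast_zmod_ne_zero hu
  have key := eulerBit_iff_legendreSym hℓ hne
  rw [← legendreSym.mod] at key
  unfold nonsqBit
  rcases h : eulerBit ℓ (u % (ℓ : ℤ)) with _ | _
  · rw [h] at key; simp only [Bool.false_eq_true, false_iff] at key; simp [key]
  · rw [h] at key; simp only [true_iff] at key; simp [key]

end Val

/-! ## §3 Integer lemmas on the tree data -/

section Tree
variable {ℓ : ℕ} [hp : Fact ℓ.Prime]

omit hp in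
/-- Unfolding of the leaf predicate: `r − ē_i ≠ 0` and `v_ℓ(r − ē_i) < j`. [folklore] -/
theorem leafOdd_eq_true_iff (e : Fin 3 → ℤ) (j : ℕ) (r : ℤ) (i : Fin 3) :
    leafOdd ℓ e j r i = true ↔ r - e i ≠ 0 ∧ valInt ℓ (r - e i) < j := by
  simp [leafOdd]

/-- A non-leaf root at level `j` has `ℓ^j ∣ r − ē_i`. [folklore] -/
theorem pow_dvd_of_leafOdd_false {e : Fin 3 → ℤ} {j : ℕ} {r : ℤ} {i : Fin 3}
    (h : leafOdd ℓ e j r i = false) : (ℓ : ℤ) ^ j ∣ r - e i := by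
  rw [pow_dvd_iff_valInt]
  by_contra hc
  simp only [not_or, not_le] at hc
  have : leafOdd ℓ e j r i = true := (leafOdd_eq_true_iff e j r i).mpr ⟨hc.1, hc.2⟩
  rw [h] at this; exact Bool.false_ne_true this

omit hp in
/-- `v_ℓ(ē_i − ē_k) ≤ nodeDepth ℓ ē` for `i ≠ k` (by definition of the depth as a maximum). [folklore] -/
theorem valInt_sub_le_nodeDepth (e : Fin 3 → ℤ) (i k : Fin 3) (hik : i ≠ k) :
    valInt ℓ (e i - e k) ≤ nodeDepth ℓ e := by
  have hs : ∀ a b : ℤ, valInt ℓ (a - b) = valInt ℓ (b - a) := fun a b => by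
    rw [← valInt_neg, neg_sub]
  fin_cases i <;> fin_cases k <;> simp [nodeDepth] at hik ⊢ <;>
    first | omega | (rw [hs]; omega)

/-- **Terminal separation**: at level `K = D + 1` two distinct roots cannot both be undetermined. [folklore] -/
theorem leafOdd_of_leafOdd_false {e : Fin 3 → ℤ} {K : ℕ} (hK : K = nodeDepth ℓ e + 1) {r : ℤ}
    {i k : Fin 3} (hik : i ≠ k) (hē : e i ≠ e k) (hi : leafOdd ℓ e K r i = false) :
    leafOdd ℓ e K r k = true := by
  by_contra hk
  rw [Bool.not_eq_true] at hk
  have h1 := pow_dvd_of_leafOdd_false hi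
  have h2 := pow_dvd_of_leafOdd_false hk
  have h3 : (ℓ : ℤ) ^ K ∣ e i - e k := by
    have := dvd_sub h2 h1
    simpa using this
  rcases (pow_dvd_iff_valInt K _).mp h3 with h0 | hle
  · exact hē (sub_eq_zero.mp h0)
  · have := valInt_sub_le_nodeDepth (ℓ := ℓ) e i k hik
    omega

omit hp in
/-- When not all three indices are leaves, `matchOdd` returns a non-leaf index. [folklore] -/
theorem leafOdd_matchOdd {e : Fin 3 → ℤ} {j : ℕ} {r : ℤ}
    (h : ¬ (leafOdd ℓ e j r 0 && leafOdd ℓ e j r 1 && leafOdd ℓ e j r 2) = true) :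
    leafOdd ℓ e j r (matchOdd ℓ e j r) = false := by
  unfold matchOdd
  revert h
  cases h0 : leafOdd ℓ e j r 0 <;> cases h1 : leafOdd ℓ e j r 1 <;> cases h2 : leafOdd ℓ e j r 2 <;>
    simp [h0, h1, h2]

omit hp in
/-- A node defers its residue to the next level (`none`) only strictly above the terminal level. [folklore] -/
theorem nodeOdd_eq_none {K : ℕ} {e : Fin 3 → ℤ} {j : ℕ} {r : ℤ} (h : nodeOdd ℓ K e j r = none) : j < K := by
  unfold nodeOdd at h
  split_ifs at h with h1 h2
  exact h2

omit hp in
/-- The bits of the two other roots plus the matching root's class give the full vector. [folklore] -/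
theorem baseOdd_add_mkOdd (e : Fin 3 → ℤ) (r : ℤ) (i : Fin 3) (c : Fin 3 → Bool × Bool)
    (h : ∀ k : Fin 3, k ≠ i → bitsOdd ℓ k.val (r - e k) = mkOdd k.val (c k).1 (c k).2) :
    baseOdd ℓ e r i + mkOdd i.val (c i).1 (c i).2 = vec3 (c 0) (c 1) (c 2) := by
  fin_cases i
  · have h1 := h 1 (by decide); have h2 := h 2 (by decide)
    simp only [Fin.val_one, Fin.val_two] at h1 h2
    simp only [baseOdd, Fin.zero_eta, Fin.isValue, ↓reduceIte, h1, h2, vec3]; omega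
  · have h0 := h 0 (by decide); have h2 := h 2 (by decide)
    simp only [Fin.val_zero, Fin.val_two] at h0 h2
    simp only [baseOdd, Fin.mk_one, Fin.isValue, one_ne_zero, ↓reduceIte, h0, h2, vec3]; omega
  · have h0 := h 0 (by decide); have h1 := h 1 (by decide)
    simp only [Fin.val_zero, Fin.val_one] at h0 h1
    simp only [baseOdd, Fin.reduceFinMk, Fin.isValue, Fin.reduceEq, ↓reduceIte, h0, h1, vec3]

omit hp in
/-- If each `bitsOdd` summand is the mask of a class `c k`, the node's bit vector is `vec3 (c 0) (c 1) (c 2)`. [folklore] -/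
theorem bvOdd_eq_vec3 (e : Fin 3 → ℤ) (r : ℤ) (c : Fin 3 → Bool × Bool)
    (h : ∀ k : Fin 3, bitsOdd ℓ k.val (r - e k) = mkOdd k.val (c k).1 (c k).2) :
    bvOdd ℓ e r = vec3 (c 0) (c 1) (c 2) := by
  have h0 := h 0; have h1 := h 1; have h2 := h 2
  simp only [Fin.val_zero, Fin.val_one, Fin.val_two] at h0 h1 h2
  simp only [bvOdd, h0, h1, h2, vec3]

end Tree

/-! ## §4 `ℓ`-adic lemmas: digits, the square condition, classes of determined roots -/

section Padic
variable {ℓ : ℕ} [hp : Fact ℓ.Prime]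

/-- Digits: `x = (x mod ℓ^n) + ℓ^n t`. [folklore] -/
theorem exists_appr_add (X : ℤ_[ℓ]) (n : ℕ) :
    ∃ t : ℤ_[ℓ], X = ((X.appr n : ℕ) : ℤ_[ℓ]) + (ℓ : ℤ_[ℓ]) ^ n * t := by
  obtain ⟨t, ht⟩ := Ideal.mem_span_singleton'.mp (PadicInt.appr_spec n X)
  exact ⟨t, by linear_combination (-1 : ℤ_[ℓ]) * ht⟩

/-- Consecutive digits: `x mod ℓ^{n+1} = (x mod ℓ^n) + a ℓ^n` with `a < ℓ`. [folklore] -/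
theorem appr_succ (X : ℤ_[ℓ]) (n : ℕ) : ∃ a : ℕ, a < ℓ ∧ X.appr (n + 1) = X.appr n + a * ℓ ^ n := by
  obtain ⟨a, ha⟩ := PadicInt.dvd_appr_sub_appr X n (n + 1) (Nat.le_succ n)
  have hmono : X.appr n ≤ X.appr (n + 1) := PadicInt.appr_mono X (Nat.le_succ n)
  have hlt : X.appr (n + 1) < ℓ ^ (n + 1) := PadicInt.appr_lt X (n + 1)
  have heq : X.appr (n + 1) = X.appr n + ℓ ^ n * a := by omega
  refine ⟨a, ?_, by rw [heq, mul_comm]⟩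
  have h1 : ℓ ^ n * a < ℓ ^ n * ℓ := by rw [← pow_succ]; omega
  exact Nat.lt_of_mul_lt_mul_left h1

/-- The square condition: if `y² = z₀ z₁ z₂`, `y ≠ 0`, the three classes XOR to zero.
[cite: Cassels1991LecturesEllipticCurves, §15] -/
theorem xor3_of_sq (S : SqClassMapOdd ℓ) {y z₀ z₁ z₂ : ℚ_[ℓ]} (hy : y ≠ 0) (h : y ^ 2 = z₀ * z₁ * z₂) :
    (((S.cls z₀).1 != (S.cls z₁).1) != (S.cls z₂).1) = false ∧
      (((S.cls z₀).2 != (S.cls z₁).2) != (S.cls z₂).2) = false := by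
  have hz : z₀ * z₁ * z₂ ≠ 0 := h ▸ pow_ne_zero 2 hy
  have hz2 : z₂ ≠ 0 := right_ne_zero_of_mul hz
  have hz01 : z₀ * z₁ ≠ 0 := left_ne_zero_of_mul hz
  have hz0 : z₀ ≠ 0 := left_ne_zero_of_mul hz01
  have hz1 : z₁ ≠ 0 := right_ne_zero_of_mul hz01
  have e1 := S.cls_mul y y hy hy
  rw [← pow_two, h, S.cls_mul _ _ hz01 hz2, S.cls_mul _ _ hz0 hz1] at e1
  simp only [bne_self_eq_false, Prod.mk.injEq] at e1
  exact e1

/-- If `y ≠ 0` and `y² = z₀ z₁ z₂` then every `z_i ≠ 0`. [folklore] -/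
theorem ne_zero_of_sq {y z₀ z₁ z₂ : ℚ_[ℓ]} (hy : y ≠ 0) (h : y ^ 2 = z₀ * z₁ * z₂) :
    z₀ ≠ 0 ∧ z₁ ≠ 0 ∧ z₂ ≠ 0 := by
  have hz : z₀ * z₁ * z₂ ≠ 0 := h ▸ pow_ne_zero 2 hy
  exact ⟨left_ne_zero_of_mul (left_ne_zero_of_mul hz), right_ne_zero_of_mul (left_ne_zero_of_mul hz),
    right_ne_zero_of_mul hz⟩

/-- **Class of a determined root**: if `z = w + ℓ^j T` with `w ∈ ℤ ∖ 0`, `v_ℓ(w) < j`, then `cls z` is M3a's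
`bitsOdd` data of `w`. [cite: Cassels1991LecturesEllipticCurves, §15] -/
theorem cls_eq_of_approx (S : SqClassMapOdd ℓ) (hℓ : ℓ ≠ 2) {z : ℚ_[ℓ]} {w : ℤ} {j : ℕ} (T : ℤ_[ℓ])
    (hw : w ≠ 0) (hv : valInt ℓ w < j) (hz : z = (w : ℚ_[ℓ]) + (ℓ : ℚ_[ℓ]) ^ j * (T : ℚ_[ℓ])) :
    S.cls z = (decide (valInt ℓ w % 2 = 1), nonsqBit ℓ (unitPart ℓ w)) := by
  have h1 := S.cls_approx z w j T hw (by rw [← valInt_eq hw]; exact hv) hz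
  rw [h1, unitPart, valInt_eq hw, nonsqBit_eq hℓ (not_dvd_div_pow_padicValInt hw)]

end Padic

end Summit.BirchSwinnertonDyer.BirchSwinnertonDyer.Rank2Observatory.TwoDescCl.SplitImage
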